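import Mathlib
import Summits.KontsevichZagierPeriods.Zeta5Search.TS1RayDominance
import Summits.KontsevichZagierPeriods.Zeta5Search.MinorTermwiseBounds
import Summits.KontsevichZagierPeriods.Zeta5Search.BigPrimeWindow
import Summits.KontsevichZagierPeriods.Zeta5Search.ValuationLawsAboveB0
import HarnessLib

/-!
# ζ(5) search — (QV) and (P̂V) on TOP_STAIR #1 = ray H1 above `8.5n`, every direction `j`, all `n` (termwise class bounds + the TS1 covers)

Cell `pub-zeta5` (HONEST FRAMING: systematic search; no irrationality claim unless certified), TRACK «DENOM-LAW» D1 prover seat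
(denom-prover-d1 g13, `HOME/denom-law/prover-d1/ATTEMPT-13.md` §4).  Two of gen-2 g5's four OBSERVED valuation laws
(`QMinorValuationLaw`: `v_p(U W⁺ − U⁺ W) ≥ refund − N_p`; `PhatMinorValuationLaw`: `v_p(U V⁺ − U⁺ V) ≥ refund − 1 − N_p`) PROVED on
TOP_STAIR #1 = ray H1, `b(n) = n·(34; 14,…,8) = bLin (8n) (6n) n`, for every `n ≥ 1`, every `1 ≤ j ≤ 7` and every prime `p` with `2p > 17n`, from
the TERMWISE bounds of `MinorTermwiseBounds` (g12; no `U`–`W`/`V` cancellation is needed on this ray): the landed covers `TS1RayCellsA…G` cell by cell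
(`checkLB` data `(A,B) = (−7,−4) … (0,0)`, `N_p` from `pairFloors_h1`): (QV) with slack ≥ 2 below `17n` and (P̂V) with slack ≥ 0 (tight on `(15n,17n]`)
— EXCEPT (QV) on `17n < p ≤ 25n` (`refund = 1`, `N_p = 0`: a genuine unit), which is the landed `W`-divisibility
`BigPrime.one_le_padicValRat_coeffW_of_slots` (slots `8n ≤ 9n ≤ 10n`, `p ≥ 15n + 1`, `p ≤ d + 1`) for `b(n)` and for `b(n) + e_j`
(`coeffW_small_of_h1like`), times the `p`-integral `U`, `U⁺`; above `b₀ = 34n` by `ValuationLawsAboveB0`.  The range `2p ≤ 17n` (counting) and the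
node-verbatim statements are `TS1RayMinorsAll`.  Brute force (g12 `minors_check.py 34,… 5`: 777 rows, 0 violations).  MODEL/structure-side valuation
bookkeeping of the cell's own rationals; the ∀-b nodes stay OPEN; nothing about ζ(5); no γ; records UNMOVED.
-/

open Finset

namespace Summit.KontsevichZagierPeriods.Zeta5Search.StairTS1

open Summit.KontsevichZagierPeriods.Zeta5Search.ClusterValuation
open Summit.KontsevichZagierPeriods.Zeta5Search.CasoratianValuation (InPolytope shift casoratian pairFloors refund minorQ minorPhat)
open Summit.KontsevichZagierPeriods.Zeta5Search.WedgeDictionary (dOf coeffU coeffW coeffV)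
open Summit.KontsevichZagierPeriods.Zeta5Search.DualSeries (InBox)
open Summit.KontsevichZagierPeriods.Zeta5Search.PadicSeries (one_le_p zpow_p_nonneg)
open Summit.KontsevichZagierPeriods.Zeta5Search.BigPrime (shift_zero dOf_shift)
open Summit.KontsevichZagierPeriods.Zeta5Search.ClassTypeCover
open Summit.KontsevichZagierPeriods.Zeta5Search.CellKit (bLin)
open Summit.KontsevichZagierPeriods.Zeta5Search.CellA (classExp_le_classNu)
open Summit.KontsevichZagierPeriods.Zeta5Search.ClusterValuation.MinorBounds

variable {p : ℕ} [hp : Fact p.Prime]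

/-! ## §1 The ray above `8.5n`, cell by cell -/

section Ray

variable {n j : ℕ} (hn : 1 ≤ n) (hj1 : 1 ≤ j) (hj7 : j ≤ 7) (hprime : p.Prime)
include hn hj1 hj7 hprime

omit hprime in
/-- The cover step with explicit termwise exponents `u ≤ min(0, B+2)`, `w ≤ min(0, B)` (numerals supplied by the caller). -/
theorem cell_minors_h1 {TY : List (List ℤ × Bool)} (h85 : 17 * n < 2 * p) (hcov : Cover (bLin (8 * n) (6 * n) n) p TY)
    {A B : ℤ} (hchk : checkLB false TY A B = true) (u w : ℤ) (hu0 : u ≤ 0) (huB : u ≤ B + 2) (hw0 : w ≤ 0) (hwB : w ≤ B) :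
    (minorQ (bLin (8 * n) (6 * n) n) j ≠ 0 → u + w ≤ padicValRat p (minorQ (bLin (8 * n) (6 * n) n) j)) ∧
    (minorPhat (bLin (8 * n) (6 * n) n) j ≠ 0 → u + A ≤ padicValRat p (minorPhat (bLin (8 * n) (6 * n) n) j)) := by
  obtain ⟨hp5, hwin⟩ := window85 hn h85
  obtain ⟨hA, hB⟩ := bounds_of_cover hcov (by rw [oddFlag_bH1lin n]; exact hchk)
  exact minors_of_bounds _ (inPolytope_h1 n) hj1 (inPolytope_shift_h1_j hn j hj1 hj7) hp5 hwin u w A hu0 hw0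
    (fun x hx h2 => by have := hB x hx h2; omega) (fun x hx h2 => by have := hB x hx h2; omega) hA

omit hj1 hj7 in
/-- `p ∣ W(c)` for an H1-LIKE vector `c` (`c₀ = 34n`; `c₁,…,c₄ ≥ 11n`; `c₅ ∈ [10n, 10n+1]`; `c₆ ∈ [9n, 9n+1]`) at `15n + 1 ≤ p ≤ d(c) + 1`:
the landed `W`-divisibility `BigPrime.one_le_padicValRat_coeffW_of_slots` on the slots `c₇ ≤ c₆ ≤ c₅`. -/
theorem coeffW_small_of_h1like (c : ℕ → ℤ) (hc : InPolytope c) (h0 : c 0 = 34 * n)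
    (h5 : 10 * (n : ℤ) ≤ c 5 ∧ c 5 ≤ 10 * n + 1) (h6 : 9 * (n : ℤ) ≤ c 6 ∧ c 6 ≤ 9 * n + 1)
    (hbig : ∀ i ∈ range 4, 11 * (n : ℤ) ≤ c (i + 1)) (hp15 : 15 * n + 1 ≤ p) (hpd : (p : ℤ) ≤ dOf c + 1) :
    padicNorm p (coeffW c) ≤ (p : ℚ) ^ (-(1 : ℤ)) := by
  refine padicNorm_le_of_val fun hW => ?_
  have hn1 : (1 : ℤ) ≤ n := by exact_mod_cast hn
  have hp' : (15 * n + 1 : ℤ) ≤ p := by exact_mod_cast hp15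
  refine BigPrime.one_le_padicValRat_coeffW_of_slots c p 6 5 4 hc.1 hc.2.1 hc.2.2 (by simp) (by simp) (by simp) (by norm_num)
    (by linarith [h5.1, h6.2]) (fun k hk hk6 hk5 => ?_) hprime (by omega) (by rw [h0]; linarith [h5.1, h6.1]) hpd hW
  simp only [mem_range] at hk
  have hb0 := hbig 0 (by simp); have hb1 := hbig 1 (by simp); have hb2 := hbig 2 (by simp); have hb3 := hbig 3 (by simp)
  simp only [Nat.reduceAdd] at hb0 hb1 hb2 hb3
  interval_cases k
  · linarith [h5.2]
  · linarith [h5.2]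
  · linarith [h5.2]
  · linarith [h5.2]
  · exact le_rfl
  · exact absurd rfl hk5
  · exact absurd rfl hk6

omit hn hj1 hj7 hprime in
/-- The ray H1 is H1-like. -/
theorem h1like_ray : ((bLin (8 * n) (6 * n) n) 0 = 34 * n) ∧
    (10 * (n : ℤ) ≤ (bLin (8 * n) (6 * n) n) 5 ∧ (bLin (8 * n) (6 * n) n) 5 ≤ 10 * n + 1) ∧
    (9 * (n : ℤ) ≤ (bLin (8 * n) (6 * n) n) 6 ∧ (bLin (8 * n) (6 * n) n) 6 ≤ 9 * n + 1) ∧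
    (∀ i ∈ range 4, 11 * (n : ℤ) ≤ (bLin (8 * n) (6 * n) n) (i + 1)) := by
  refine ⟨w0 n, by rw [w5]; constructor <;> linarith, by rw [w6]; constructor <;> linarith, fun i hi => ?_⟩
  simp only [mem_range] at hi
  interval_cases i <;> simp only [Nat.reduceAdd, w1, w2, w3, w4] <;> linarith

omit hn hprime in
/-- Every contiguous shift of the ray H1 is H1-like. -/
theorem h1like_shift : ((shift (bLin (8 * n) (6 * n) n) j) 0 = 34 * n) ∧
    (10 * (n : ℤ) ≤ (shift (bLin (8 * n) (6 * n) n) j) 5 ∧ (shift (bLin (8 * n) (6 * n) n) j) 5 ≤ 10 * n + 1) ∧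
    (9 * (n : ℤ) ≤ (shift (bLin (8 * n) (6 * n) n) j) 6 ∧ (shift (bLin (8 * n) (6 * n) n) j) 6 ≤ 9 * n + 1) ∧
    (∀ i ∈ range 4, 11 * (n : ℤ) ≤ (shift (bLin (8 * n) (6 * n) n) j) (i + 1)) := by
  have hs : ∀ i, shift (bLin (8 * n) (6 * n) n) j i = if i = j then bLin (8 * n) (6 * n) n j + 1 else bLin (8 * n) (6 * n) n i := by
    intro i; simp only [shift, Function.update_apply]
  interval_cases j <;>
  · refine ⟨?_, ?_, ?_, fun i hi => ?_⟩
    · rw [hs]; simp only [Nat.reduceEqDiff, if_false, w0]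
    · simp only [hs, Nat.reduceEqDiff, if_true, if_false, w5]; constructor <;> linarith
    · simp only [hs, Nat.reduceEqDiff, if_true, if_false, w6]; constructor <;> linarith
    · simp only [mem_range] at hi
      interval_cases i <;> simp only [hs, Nat.reduceAdd, Nat.reduceEqDiff, if_true, if_false, w1, w2, w3, w4] <;> linarith

/-- **(QV) needs a unit on `17n < p ≤ 25n`** (`refund = 1`, `N_p = 0`): there `p ∣ W(b(n))` and `p ∣ W(b(n)+e_j)` (`coeffW_small_of_h1like`;
`p ≥ 15n + 1`, `p ≤ d + 1` resp. `≤ d(b⁺) + 1 = 25n`), and `U`, `U⁺` are `p`-integral (every multipole class has `5 + E ≥ 0`). -/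
theorem minorQ_c17 (hA : 17 * n < p) (hB : p ≤ 25 * n) (hne : minorQ (bLin (8 * n) (6 * n) n) j ≠ 0) :
    (1 : ℤ) ≤ padicValRat p (minorQ (bLin (8 * n) (6 * n) n) j) := by
  obtain ⟨hp5, hwin⟩ := window85 hn (by omega : 17 * n < 2 * p)
  have hp2 : p % 2 = 1 := Nat.odd_iff.1 (hprime.odd_of_ne_two (by omega))
  have hb : InPolytope (bLin (8 * n) (6 * n) n) := inPolytope_h1 n
  have hb' : InPolytope (shift (bLin (8 * n) (6 * n) n) j) := inPolytope_shift_h1_j hn j hj1 hj7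
  have h0' : shift (bLin (8 * n) (6 * n) n) j 0 = bLin (8 * n) (6 * n) n 0 := shift_zero _ hj1
  have hwin' : (shift (bLin (8 * n) (6 * n) n) j 0 + 2 : ℤ) < (p : ℤ) ^ 2 := by rw [h0']; exact hwin
  obtain ⟨-, hBm⟩ := bounds_of_cover (cover_c17 (n := n) (p := p) (by omega) (by omega) hp2) (by rw [oddFlag_bH1lin n]; exact checkM_c17)
  have hum : ∀ x, x < p → 2 ≤ classPoleCount (bLin (8 * n) (6 * n) n) p x → (0 : ℤ) ≤ 5 + classExp (bLin (8 * n) (6 * n) n) p x :=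
    fun x hx h2 => by have := hBm x hx h2; omega
  have hcnt : ∀ x, classPoleCount (shift (bLin (8 * n) (6 * n) n) j) p x ≤ classPoleCount (bLin (8 * n) (6 * n) n) p x :=
    fun x => classPoleCount_shift_le _ hb.1 hj1 p x
  have hum' : ∀ x, x < p → 2 ≤ classPoleCount (shift (bLin (8 * n) (6 * n) n) j) p x → (0 : ℤ) ≤ 5 + classExp (shift (bLin (8 * n) (6 * n) n) j) p x :=
    fun x hx h2 => (hum x hx (le_trans h2 (hcnt x))).trans (by linarith [classExp_shift_ge _ hb.1 hj1 p x])
  have hU := coeffU_norm_le _ hb hp5 hwin 0 le_rfl hum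
  have hU' := coeffU_norm_le _ hb' hp5 hwin' 0 le_rfl hum'
  obtain ⟨g0, g5, g6, gbig⟩ := h1like_ray (n := n)
  obtain ⟨s0, s5, s6, sbig⟩ := h1like_shift (n := n) (j := j) hj1 hj7
  have hW := coeffW_small_of_h1like (p := p) hn hprime _ hb g0 g5 g6 gbig (by omega) (by rw [dOf_h1]; omega)
  have hW' := coeffW_small_of_h1like (p := p) hn hprime _ hb' s0 s5 s6 sbig (by omega)
    (by rw [dOf_shift _ hj1 hj7, dOf_h1]; omega)
  apply val_ge_of_padicNorm_le hne
  rw [minorQ, show (-(1 : ℤ)) = -((0 : ℤ) + 1) by norm_num]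
  exact minor_norm_le hU hU' hW hW'

/-- **(QV) and (P̂V) at every prime with `2p > 17n`**, cell by cell (the `(A, B)` data of the landed covers). -/
theorem minors_gt85 (h85 : 17 * n < 2 * p) :
    (minorQ (bLin (8 * n) (6 * n) n) j ≠ 0 →
      refund (bLin (8 * n) (6 * n) n) p - pairFloors (bLin (8 * n) (6 * n) n) p ≤ padicValRat p (minorQ (bLin (8 * n) (6 * n) n) j)) ∧
    (minorPhat (bLin (8 * n) (6 * n) n) j ≠ 0 →
      refund (bLin (8 * n) (6 * n) n) p - 1 - pairFloors (bLin (8 * n) (6 * n) n) p ≤ padicValRat p (minorPhat (bLin (8 * n) (6 * n) n) j)) := by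
  have hp0 : 0 < p := hprime.pos
  have hp2 := odd_of_prime_gt85 hprime h85 hn
  obtain ⟨hp5, hwin⟩ := window85 hn h85
  by_cases h34 : 34 * n < p
  · have hpb : (bLin (8 * n) (6 * n) n) 0 + 1 ≤ (p : ℤ) := by rw [w0]; exact_mod_cast (show 34 * n + 1 ≤ p by omega)
    exact ⟨fun hne => BigPrime.qMinorValuationLaw_above _ j p (inPolytope_h1 n) hj1 hj7 (inPolytope_shift_h1_j hn j hj1 hj7) hprime hp5 hpb hne,
      fun hne => BigPrime.phatMinorValuationLaw_above _ j p (inPolytope_h1 n) hj1 (inPolytope_shift_h1_j hn j hj1 hj7) hprime hpb hne⟩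
  by_cases h25 : 25 * n < p
  · rw [refund_h1_zero h25, N_gt17 (by omega)]
    have hc := cell_minors_h1 hn hj1 hj7 h85 (cover_c25 (by omega) (by omega) hp2) checkM_c25 0 0 le_rfl (by norm_num) le_rfl le_rfl
    exact ⟨fun hne => by linarith [hc.1 hne], fun hne => by linarith [hc.2 hne]⟩
  push Not at h25
  rw [refund_h1_one hp0 h25]
  by_cases h : p ≤ 9 * n
  · rw [N_c8 h85 h]
    have hc := cell_minors_h1 hn hj1 hj7 h85 (cover_c8 h85 (by omega) hp2) checkM_c8 (-2) (-4) (by norm_num) (by norm_num) (by norm_num) le_rfl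
    exact ⟨fun hne => by linarith [hc.1 hne], fun hne => by linarith [hc.2 hne]⟩
  by_cases h' : p ≤ 10 * n
  · rw [N_c9 (by omega) h']
    have hc := cell_minors_h1 hn hj1 hj7 h85 (cover_c9 (by omega) (by omega) hp2) checkM_c9 (-1) (-3) (by norm_num) (by norm_num) (by norm_num) le_rfl
    exact ⟨fun hne => by linarith [hc.1 hne], fun hne => by linarith [hc.2 hne]⟩
  by_cases h : p ≤ 11 * n
  · rw [N_c10 (by omega) h]
    have hc := cell_minors_h1 hn hj1 hj7 h85 (cover_c10 (by omega) (by omega) hp2) checkM_c10 (-1) (-3) (by norm_num) (by norm_num) (by norm_num) le_rfl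
    exact ⟨fun hne => by linarith [hc.1 hne], fun hne => by linarith [hc.2 hne]⟩
  by_cases h' : 3 * p ≤ 34 * n
  · rw [N_c11 (by omega) (by omega)]
    have hc := cell_minors_h1 hn hj1 hj7 h85 (cover_c11a (by omega) h' hp2) checkM_c11a 0 (-2) le_rfl (by norm_num) (by norm_num) le_rfl
    exact ⟨fun hne => by linarith [hc.1 hne], fun hne => by linarith [hc.2 hne]⟩
  by_cases h : p ≤ 12 * n
  · rw [N_c11 (by omega) h]
    have hc := cell_minors_h1 hn hj1 hj7 h85 (cover_c11b (by omega) (by omega) hp2) checkM_c11b (-1) (-3) (by norm_num) (by norm_num) (by norm_num) le_rfl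
    exact ⟨fun hne => by linarith [hc.1 hne], fun hne => by linarith [hc.2 hne]⟩
  by_cases h' : 2 * p < 25 * n
  · rw [N_c12 (by omega) (by omega)]
    have hc := cell_minors_h1 hn hj1 hj7 h85 (cover_c12a (by omega) h' hp2) checkM_c12a 0 (-2) le_rfl (by norm_num) (by norm_num) le_rfl
    exact ⟨fun hne => by linarith [hc.1 hne], fun hne => by linarith [hc.2 hne]⟩
  by_cases h : p ≤ 13 * n
  · have h25' : 25 * n < 2 * p := by
      rcases Nat.lt_or_ge (25 * n) (2 * p) with hlt | hge
      · exact hlt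
      · exfalso
        have heq : 2 * p = 25 * n := by omega
        have h5 : 5 ∣ p := by
          have : 5 ∣ 2 * p := ⟨5 * n, by omega⟩
          exact (Nat.Coprime.dvd_of_dvd_mul_left (by norm_num) this)
        have := (Nat.prime_dvd_prime_iff_eq (by norm_num) hprime).1 h5
        omega
    rw [N_c12 (by omega) h]
    have hc := cell_minors_h1 hn hj1 hj7 h85 (cover_c12b h25' (by omega) hp2) checkM_c12b 0 (-2) le_rfl (by norm_num) (by norm_num) le_rfl
    exact ⟨fun hne => by linarith [hc.1 hne], fun hne => by linarith [hc.2 hne]⟩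
  by_cases h' : p ≤ 14 * n
  · rw [N_c13 (by omega) h']
    have hc := cell_minors_h1 hn hj1 hj7 h85 (cover_c13 (by omega) (by omega) hp2) checkM_c13 0 (-1) le_rfl (by norm_num) (by norm_num) le_rfl
    exact ⟨fun hne => by linarith [hc.1 hne], fun hne => by linarith [hc.2 hne]⟩
  by_cases h : p ≤ 15 * n
  · rw [N_c14 (by omega) h]
    have hc := cell_minors_h1 hn hj1 hj7 h85 (cover_c14 (by omega) (by omega) hp2) checkM_c14 0 0 le_rfl (by norm_num) le_rfl le_rfl
    exact ⟨fun hne => by linarith [hc.1 hne], fun hne => by linarith [hc.2 hne]⟩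
  by_cases h' : p ≤ 16 * n
  · rw [N_c15 (by omega) h']
    have hc := cell_minors_h1 hn hj1 hj7 h85 (cover_c15 (by omega) (by omega) hp2) checkM_c15 0 0 le_rfl (by norm_num) le_rfl (by norm_num)
    exact ⟨fun hne => by linarith [hc.1 hne], fun hne => by linarith [hc.2 hne]⟩
  by_cases h : p ≤ 17 * n
  · rw [N_c16 (by omega) h]
    have hc := cell_minors_h1 hn hj1 hj7 h85 (cover_c16 (by omega) (by omega) hp2) checkM_c16 0 0 le_rfl (by norm_num) le_rfl (by norm_num)
    exact ⟨fun hne => by linarith [hc.1 hne], fun hne => by linarith [hc.2 hne]⟩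
  · rw [N_gt17 (by omega)]
    have hc := cell_minors_h1 hn hj1 hj7 h85 (cover_c17 (by omega) (by omega) hp2) checkM_c17 0 0 le_rfl (by norm_num) le_rfl (by norm_num)
    exact ⟨fun hne => by linarith [minorQ_c17 hn hj1 hj7 hprime (by omega) h25 hne], fun hne => by linarith [hc.2 hne]⟩

end Ray

end Summit.KontsevichZagierPeriods.Zeta5Search.StairTS1
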